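import Literature.AlgebraicGeometry.Motives.AbelianVarietyWeilDivisorClassPullbackHom
import Literature.AlgebraicGeometry.Motives.CartierDivisorCurveDegree
import Literature.AlgebraicGeometry.Motives.AlgPointsMapSurjectiveAlgClosed
import HarnessLib

/-!
# Translation classes pulled back to a curve have degree `0`: `deg f^♮(t_y^*Θ − Θ) = 0`
# (Mumford, *Abelian Varieties*, §8 (iv); Lange 2023, §4.5 — road G4, letter (DEG))

Layer `Literature/AlgebraicGeometry/Motives`, namespace `Literature.AlgebraicGeometry.Motives.AbelianVariety`.
KERNEL ONLY: theorems; no definition, no named fact, no instance, no `sorry`.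

For an abelian variety `A` over an algebraically closed field `k` of characteristic `0`, a Cartier divisor `Θ` on `A`, a point
`y ∈ A(k)` with translation class `D_y := t_y^*Θ − Θ` (★ `AbelianVariety.weilDiv Θ y`, the divisor of `φ_Θ(y) ∈ Pic⁰(A)`), and ANY
morphism `f : C → A` from an integral proper curve (`height ⊤ = 1` in the specialisation order, the hypothesis under which the tree's
degree ★ `CartierDivisor.degree` is a class function, ★ `LinEquiv.degree_eq`), the class pull-back `f^♮ D_y` (★ `CartierDivisor.classPullback`)
has DEGREE ZERO.  Proof (the letter's): `y ↦ deg f^♮ D_y` is a group homomorphism `A(k) → ℤ` — the theorem of the square pulled back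
along `f`, i.e. the (3b) engine ★ `AbelianVariety.aj_classPullback_weilDiv_pow` of `Motives/AbelianVarietyWeilDivisorClassPullbackHom` at the
additive class function `aj := deg` (★ `degree_add`, ★ `LinEquiv.degree_eq`) — and `A(k)` is divisible (★ `pow_surjective_of_isAlgClosed`:
`y = xⁿ` for every `n ≥ 1`), so `deg f^♮ D_y = n · deg f^♮ D_x` is divisible by every `n`, hence `0`.

* **`degree_classPullback_weilDiv_eq_zero_of_isAlgClosed`** — any algebraically closed `k` of characteristic `0`;
* **`degree_classPullback_weilDiv_eq_zero`** — the LETTER (DEG) of the road G4 sockets v3 (A-p04 (g17), §1′) over `ℂ`, token for token;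
* `degree_pullback_weilDiv_eq_zero` — dominant edition with the honest pull-back (★ `classPullback_linEquiv_pullback`).

Cell `hodgecm-mathlib` (D-0151), crux HLiu418 = stmt-HodgeConjecture-24832, road G4 ([Lange2023] (4.9) ⇒ VI-8): GLUE I compares `α_c^♮` of
`Nm^* D_y` and of `D_{ty}` through `aj_c`, which is only defined on degree-`0` divisors — this file supplies the degree.  COUNT-NEUTRAL
capital; HC_CM is proved only modulo the 7 printed citations until rung 0 closes.

## References
* [MumfordAV1970] D. Mumford, *Abelian Varieties* (1970), §8 (pp. 74–75): (iv) `Pic⁰` is functorial, and §6 Cor. 4 (p. 59, theorem of the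
  square); §6 Application 2 (p. 62: `A(k)` is divisible for `k = k̄`).
* [Lange2023AbelianVarietiesComplex] H. Lange, *Abelian Varieties over the Complex Numbers* (2023), §2.2 (`Pic⁰`, translation classes are
  algebraically equivalent to `0`) and §4.5.2 (finite coverings of curves; degrees of pulled-back classes).
-/

noncomputable section

universe u

open CategoryTheory AlgebraicGeometry Order

namespace Literature.AlgebraicGeometry.Motives

namespace AbelianVariety

section AlgClosed

variable {k : Type u} [Field k] [IsAlgClosed k] [CharZero k]
  {C : SchemeOver k} [IsIntegral C.left] [IsProper C.hom] {A : AbelianVariety k}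

/-- **`deg f^♮(t_y^*Θ − Θ) = 0`** for every morphism `f : C → A` from an integral proper curve over an algebraically closed field of
characteristic `0`, every Cartier divisor `Θ` on the abelian variety `A` and every `y ∈ A(k)`: `y ↦ deg f^♮ D_y` is a homomorphism
`A(k) → ℤ` (theorem of the square + additivity of class pull-back and degree, ★ `aj_classPullback_weilDiv_pow` at `aj = deg`) and `A(k)` is
divisible (★ `pow_surjective_of_isAlgClosed`), so its image is a divisible subgroup of `ℤ`, i.e. `0`.
[cite: MumfordAV1970, §8 (iv) (p. 75), §6 Cor. 4 (p. 59) and §6 Application 2 (p. 62)] [cite: Lange2023AbelianVarietiesComplex, §2.2 and §4.5.2] -/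
theorem degree_classPullback_weilDiv_eq_zero_of_isAlgClosed (hC : height (⊤ : C.left) = 1) (f : C.left ⟶ A.X.left)
    (Θ : CartierDivisor A.X.left) (y : A.Points k) :
    CartierDivisor.degree C ((A.weilDiv Θ y).classPullback f) = 0 := by
  -- the additive class function `deg`, written multiplicatively
  let aj : CartierDivisor C.left → Multiplicative ℤ := fun D => Multiplicative.ofAdd (CartierDivisor.degree C D)
  have haj_add : ∀ D E : CartierDivisor C.left, aj (D + E) = aj D * aj E := fun D E => by
    simp only [aj, CartierDivisor.degree_add, ofAdd_add]
  have haj_lin : ∀ D E : CartierDivisor C.left, D.LinEquiv E → aj D = aj E := fun D E h => by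
    simp only [aj, h.degree_eq hC]
  -- `deg f^♮ D_{xⁿ} = n · deg f^♮ D_x`
  have hpow : ∀ (x : A.Points k) (n : ℕ),
      CartierDivisor.degree C ((A.weilDiv Θ (x ^ n)).classPullback f) = n * CartierDivisor.degree C ((A.weilDiv Θ x).classPullback f) := by
    intro x n
    have h := aj_classPullback_weilDiv_pow f aj haj_add haj_lin Θ x n
    simp only [aj] at h
    have h' := congrArg Multiplicative.toAdd h
    rwa [toAdd_ofAdd, toAdd_pow, toAdd_ofAdd, nsmul_eq_mul] at h'
  -- divisibility: `y = x ^ n` with `n = |deg| + 1`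
  set d := CartierDivisor.degree C ((A.weilDiv Θ y).classPullback f) with hd
  by_contra hne
  set n : ℕ := d.natAbs + 1 with hn
  have hn0 : (n : k) ≠ 0 := by exact_mod_cast Nat.succ_ne_zero d.natAbs
  obtain ⟨x, hx⟩ := A.pow_surjective_of_isAlgClosed n hn0 y
  have hdiv : (n : ℤ) ∣ d := by
    refine ⟨CartierDivisor.degree C ((A.weilDiv Θ x).classPullback f), ?_⟩
    rw [hd, ← hpow x n]
    exact congrArg (fun z => CartierDivisor.degree C ((A.weilDiv Θ z).classPullback f)) hx.symm
  have hlt : d.natAbs < (n : ℤ).natAbs := by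
    rw [Int.natAbs_natCast]; exact Nat.lt_succ_self _
  exact hne (Int.eq_zero_of_dvd_of_natAbs_lt_natAbs hdiv hlt)

/-- **Dominant edition** (`f` dominant, e.g. a finite cover of a curve in `A` or a translate of the Abel–Jacobi curve composed with an
isogeny): `deg f^*(t_y^*Θ − Θ) = 0` with the honest pull-back (★ `classPullback_linEquiv_pullback`).
[cite: MumfordAV1970, §8 (iv) (p. 75) and §6 Application 2 (p. 62)] -/
theorem degree_pullback_weilDiv_eq_zero_of_isAlgClosed (hC : height (⊤ : C.left) = 1) (f : C.left ⟶ A.X.left) [IsDominant f]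
    (Θ : CartierDivisor A.X.left) (y : A.Points k) :
    CartierDivisor.degree C ((A.weilDiv Θ y).pullback f) = 0 := by
  rw [← ((A.weilDiv Θ y).classPullback_linEquiv_pullback f).degree_eq hC]
  exact degree_classPullback_weilDiv_eq_zero_of_isAlgClosed hC f Θ y

end AlgClosed

section Complex

variable {C : SchemeOver ℂ} [IsIntegral C.left] [IsProper C.hom] {A : AbelianVariety ℂ}

/-- **Road G4, letter (DEG) (A-p04 (g17) sockets v3 §1′, VERBATIM): `deg f^♮(t_y^*Θ − Θ) = 0`** for any morphism `f : C → A` from an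
integral proper complex curve, any divisor `Θ` on the complex abelian variety `A`, and any `y ∈ A(ℂ)`.
[cite: MumfordAV1970, §8 (iv) (p. 75) and §6 Application 2 (p. 62)] [cite: Lange2023AbelianVarietiesComplex, §4.5.2] -/
theorem degree_classPullback_weilDiv_eq_zero (hC : Order.height (⊤ : C.left) = 1) (f : C.left ⟶ A.X.left)
    (Θ : CartierDivisor A.X.left) (y : A.Points ℂ) :
    CartierDivisor.degree C ((A.weilDiv Θ y).classPullback f) = 0 :=
  degree_classPullback_weilDiv_eq_zero_of_isAlgClosed hC f Θ y

/-- The dominant edition over `ℂ`. [cite: MumfordAV1970, §8 (iv) (p. 75) and §6 Application 2 (p. 62)] -/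
theorem degree_pullback_weilDiv_eq_zero (hC : Order.height (⊤ : C.left) = 1) (f : C.left ⟶ A.X.left) [IsDominant f]
    (Θ : CartierDivisor A.X.left) (y : A.Points ℂ) :
    CartierDivisor.degree C ((A.weilDiv Θ y).pullback f) = 0 :=
  degree_pullback_weilDiv_eq_zero_of_isAlgClosed hC f Θ y

end Complex

end AbelianVariety

end Literature.AlgebraicGeometry.Motives

end
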